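import Mathlib
import Summits.CriticalPhenomena.CardyFormulaZ2.Theorems.CardySelfRefinementDefs
import Summits.CriticalPhenomena.CardyFormulaZ2.Theorems.CardySelfRefinementTrivialSectorRateStubLocalEngineRotation
import Summits.CriticalPhenomena.CardyFormulaZ2.Theorems.CardySelfRefinementTrivialSectorRateStubLocalEngineRotationCoins
import Summits.CriticalPhenomena.CardyFormulaZ2.Theorems.CardySelfRefinementTrivialSectorRateStubLocalEngineRotationWindow
import Summits.CriticalPhenomena.CardyFormulaZ2.Theorems.CardySelfRefinementTrivialSectorRateStubLocalEngineOrbitOrder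
import Literature.Probability.Percolation.SelfRefinementMeasure
import HarnessLib

/-!
# Stub `stub_localEngine` of line `far-field-is-a-quarter-turn` (crux `TrivialSectorRate`,
stmt-CriticalPhenomena-10266): `C₄`-INVARIANT pairs have `C₄`-invariant conditional influences

Companion of `…StubLocalEngineRotationWindow.lean` (`cond_infl_quarterTurn_window`) and
`…StubLocalEngineOrbitOrder.lean` (the `σ`-cycles).  Setting of the engine `stub_localEngine`:
window `K = coinWindow k (boxEdgesAt (ctr k u) R)`, `k ∣ R`, conditional law
`ν = (coinLaw k q).map (· ∩ K)`, boundary condition `S₁`, event `B` read through `cfg k`,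
conditional signed influence
`Φ(S₁, B, i) = ν {T | insert i (T ∪ (S₁ \ K)) ∈ cfg k ⁻¹' B} − ν {T | (T ∪ (S₁ \ K)) \ {i} ∈ cfg k ⁻¹' B}`
(inline everywhere).  If the pair is invariant under the quarter turn about `k•u` —
`σ ⁻¹' S₁ = S₁` and `{ω | g '' ω ∈ B} = B` (equivalent `g.symm` / `σ.symm` forms:
`relabel_symm_preimage_eq_self_iff`, `coin_symm_preimage_eq_self_iff`) — then

* `Φ(S₁, B, σ i) = Φ(S₁, B, i)` for EVERY coin `i` (`cond_infl_quarterTurn_coin_of_invariant`,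
  registered): the conditional influence is constant on `σ`-orbits;
* the four selector influences at `u` coincide (`cond_infl_selector_eq_east_of_invariant`) and the
  `Tρ`-type orbit sum is `4 ×` the east one (`bundleSum_cond_infl_of_invariant`, registered);
* the interior-edge sums of the four cells at `u` coincide
  (`sum_interiorEdges_cond_infl_eq_of_invariant`) and the `Tc`-type double sum is `4 ×` that of the
  north-east cell `u` (`cellSum_cond_infl_of_invariant`, registered).

ANY event `B`, ANY `S₁` (no measurability).
-/

noncomputable section

namespace Summit.CriticalPhenomena.CardyFormulaZ2.Theorems.CardySelfRefinement.FarField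

open Set MeasureTheory
open Literature.Probability.LatticeModels Literature.Probability.Percolation
open Literature.Probability.Percolation.QuadCrossing
open Summit.CriticalPhenomena.CardyFormulaZ2.Theses.CardySelfRefinement

/-! ### Invariance under `g` and under `g⁻¹` are the same thing -/

/-- An event is invariant under the pull-back along `g⁻¹` iff it is invariant under the pull-back
along `g`. -/
theorem relabel_symm_preimage_eq_self_iff (g : Site 2 ≃ Site 2) (B : Set (BondConfig (Site 2))) :
    BondConfig.relabel (sym2Equiv g.symm) ⁻¹' B = B ↔ BondConfig.relabel (sym2Equiv g) ⁻¹' B = B := by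
  constructor
  · intro hB
    have e : BondConfig.relabel (sym2Equiv g) ⁻¹' (BondConfig.relabel (sym2Equiv g.symm) ⁻¹' B) = B := by
      ext ω
      simp only [Set.mem_preimage, relabel_symm_relabel]
    rwa [hB] at e
  · intro hB
    have e : BondConfig.relabel (sym2Equiv g.symm) ⁻¹' (BondConfig.relabel (sym2Equiv g) ⁻¹' B) = B := by
      ext ω
      have h' := relabel_symm_relabel g.symm ω
      rw [Equiv.symm_symm] at h'
      simp only [Set.mem_preimage, h']
    rwa [hB] at e

/-- A coin set is invariant under the pull-back along `σ⁻¹` iff it is invariant under the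
pull-back along `σ`. -/
theorem coin_symm_preimage_eq_self_iff (σ : Coin ≃ Coin) (S₁ : Set Coin) :
    σ.symm ⁻¹' S₁ = S₁ ↔ σ ⁻¹' S₁ = S₁ := by
  constructor
  · intro hS
    have e := Equiv.preimage_symm_preimage σ S₁
    rwa [hS] at e
  · intro hS
    have e := Equiv.symm_preimage_preimage σ S₁
    rwa [hS] at e

/-! ### Invariant pairs: the conditional influence is constant on `σ`-orbits -/

/-- **Invariant pairs give `σ`-invariant conditional influences** (`k ≠ 0`, `k ∣ R`; ANY `S₁`,
`B` with `σ ⁻¹' S₁ = S₁` and `{ω | g '' ω ∈ B} = B`): `Φ(S₁, B, σ i) = Φ(S₁, B, i)` for every coin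
`i` — window `K = coinWindow k (boxEdgesAt (ctr k u) R)`, law `(coinLaw k q).map (· ∩ K)`
(corollary of `cond_infl_quarterTurn_window`). -/
theorem cond_infl_quarterTurn_coin_of_invariant {k : ℕ} (hk : k ≠ 0) (q : ℝ × ℝ) (u : Site 2)
    (g : Site 2 ≃ Site 2) (σ : Coin ≃ Coin)
    (hg : ∀ x, g x = ![ctr k u 0 + ctr k u 1 - x 1, x 0 - ctr k u 0 + ctr k u 1])
    (h0 : ∀ (v : Site 2) (d : Fin 2), σ (v, d, 0) =
      (![v 1 - ctr k u 1 + ctr k u 0, ctr k u 0 + ctr k u 1 - v 0 - (if d = 0 then 1 else 0)],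
        Equiv.swap 0 1 d, 0))
    (h : ∀ (t : Site 2) (d : Fin 2) (j : Fin 3), j ≠ 0 → σ (t, d, j) =
      (![t 1 - u 1 + u 0, u 0 + u 1 - t 0 - (if d = 0 then 1 else 0)], Equiv.swap 0 1 d, j))
    {R : ℕ} (hR : k ∣ R) {S₁ : Set Coin} {B : Set (BondConfig (Site 2))}
    (hS : σ ⁻¹' S₁ = S₁) (hB : BondConfig.relabel (sym2Equiv g) ⁻¹' B = B) (i : Coin) :
    (((coinLaw k q).map (fun T : Set Coin => T ∩ coinWindow k (boxEdgesAt (ctr k u) R))).real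
        {T | insert (σ i) (T ∪ (S₁ \ coinWindow k (boxEdgesAt (ctr k u) R))) ∈
          cfg k ⁻¹' B} -
      ((coinLaw k q).map (fun T : Set Coin => T ∩ coinWindow k (boxEdgesAt (ctr k u) R))).real
        {T | (T ∪ (S₁ \ coinWindow k (boxEdgesAt (ctr k u) R))) \ {σ i} ∈
          cfg k ⁻¹' B}) =
      (((coinLaw k q).map (fun T : Set Coin => T ∩ coinWindow k (boxEdgesAt (ctr k u) R))).real
          {T | insert i (T ∪ (S₁ \ coinWindow k (boxEdgesAt (ctr k u) R))) ∈
            cfg k ⁻¹' B} -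
        ((coinLaw k q).map (fun T : Set Coin => T ∩ coinWindow k (boxEdgesAt (ctr k u) R))).real
          {T | (T ∪ (S₁ \ coinWindow k (boxEdgesAt (ctr k u) R))) \ {i} ∈
            cfg k ⁻¹' B}) := by
  have e := cond_infl_quarterTurn_window hk q u g σ hg h0 h hR S₁ B (σ i)
  rw [hB, hS, Equiv.symm_apply_apply] at e
  exact e

/-! ### The four selectors at `u` -/

/-- **For an invariant pair the four selector influences at `u` coincide** with that of the east
selector `(u, 0, 2)` (the selectors of `bundlesAt u` form one `σ`-cycle,
`quarterTurn_coin_east_orbit`). -/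
theorem cond_infl_selector_eq_east_of_invariant {k : ℕ} (hk : k ≠ 0) (q : ℝ × ℝ) (u : Site 2)
    (g : Site 2 ≃ Site 2) (σ : Coin ≃ Coin)
    (hg : ∀ x, g x = ![ctr k u 0 + ctr k u 1 - x 1, x 0 - ctr k u 0 + ctr k u 1])
    (h0 : ∀ (v : Site 2) (d : Fin 2), σ (v, d, 0) =
      (![v 1 - ctr k u 1 + ctr k u 0, ctr k u 0 + ctr k u 1 - v 0 - (if d = 0 then 1 else 0)],
        Equiv.swap 0 1 d, 0))
    (h : ∀ (t : Site 2) (d : Fin 2) (j : Fin 3), j ≠ 0 → σ (t, d, j) =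
      (![t 1 - u 1 + u 0, u 0 + u 1 - t 0 - (if d = 0 then 1 else 0)], Equiv.swap 0 1 d, j))
    {R : ℕ} (hR : k ∣ R) {S₁ : Set Coin} {B : Set (BondConfig (Site 2))}
    (hS : σ ⁻¹' S₁ = S₁) (hB : BondConfig.relabel (sym2Equiv g) ⁻¹' B = B) {b : Site 2 × Fin 2} (hb : b ∈ bundlesAt u) :
    (((coinLaw k q).map (fun T : Set Coin => T ∩ coinWindow k (boxEdgesAt (ctr k u) R))).real
        {T | insert (b.1, b.2, (2 : Fin 3)) (T ∪ (S₁ \ coinWindow k (boxEdgesAt (ctr k u) R))) ∈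
          cfg k ⁻¹' B} -
      ((coinLaw k q).map (fun T : Set Coin => T ∩ coinWindow k (boxEdgesAt (ctr k u) R))).real
        {T | (T ∪ (S₁ \ coinWindow k (boxEdgesAt (ctr k u) R))) \ {(b.1, b.2, (2 : Fin 3))} ∈
          cfg k ⁻¹' B}) =
      (((coinLaw k q).map (fun T : Set Coin => T ∩ coinWindow k (boxEdgesAt (ctr k u) R))).real
          {T | insert (u, 0, (2 : Fin 3)) (T ∪ (S₁ \ coinWindow k (boxEdgesAt (ctr k u) R))) ∈
            cfg k ⁻¹' B} -
        ((coinLaw k q).map (fun T : Set Coin => T ∩ coinWindow k (boxEdgesAt (ctr k u) R))).real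
          {T | (T ∪ (S₁ \ coinWindow k (boxEdgesAt (ctr k u) R))) \ {(u, 0, (2 : Fin 3))} ∈
            cfg k ⁻¹' B}) := by
  have inv := cond_infl_quarterTurn_coin_of_invariant hk q u g σ hg h0 h hR hS hB
  obtain ⟨o1, o2, o3, -⟩ := quarterTurn_coin_east_orbit u σ h (j := 2) (by decide)
  have i1 := inv (u, 0, 2)
  rw [o1] at i1
  have i2 := inv (σ (u, 0, 2))
  rw [o2, o1, i1] at i2
  have i3 := inv (σ (σ (u, 0, 2)))
  rw [o3, o2, i2] at i3
  simp only [bundlesAt, Finset.mem_insert, Finset.mem_singleton] at hb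
  rcases hb with rfl | rfl | rfl | rfl
  exacts [rfl, i3, i2, i1]

/-- **For an invariant pair the `Tρ`-type conditional orbit sum is four times the east selector
influence.** -/
theorem bundleSum_cond_infl_of_invariant {k : ℕ} (hk : k ≠ 0) (q : ℝ × ℝ) (u : Site 2)
    (g : Site 2 ≃ Site 2) (σ : Coin ≃ Coin)
    (hg : ∀ x, g x = ![ctr k u 0 + ctr k u 1 - x 1, x 0 - ctr k u 0 + ctr k u 1])
    (h0 : ∀ (v : Site 2) (d : Fin 2), σ (v, d, 0) =
      (![v 1 - ctr k u 1 + ctr k u 0, ctr k u 0 + ctr k u 1 - v 0 - (if d = 0 then 1 else 0)],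
        Equiv.swap 0 1 d, 0))
    (h : ∀ (t : Site 2) (d : Fin 2) (j : Fin 3), j ≠ 0 → σ (t, d, j) =
      (![t 1 - u 1 + u 0, u 0 + u 1 - t 0 - (if d = 0 then 1 else 0)], Equiv.swap 0 1 d, j))
    {R : ℕ} (hR : k ∣ R) {S₁ : Set Coin} {B : Set (BondConfig (Site 2))}
    (hS : σ ⁻¹' S₁ = S₁) (hB : BondConfig.relabel (sym2Equiv g) ⁻¹' B = B) :
    ∑ b ∈ bundlesAt u,
        (((coinLaw k q).map (fun T : Set Coin => T ∩ coinWindow k (boxEdgesAt (ctr k u) R))).real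
            {T | insert (b.1, b.2, (2 : Fin 3)) (T ∪ (S₁ \ coinWindow k (boxEdgesAt (ctr k u) R))) ∈
              cfg k ⁻¹' B} -
          ((coinLaw k q).map (fun T : Set Coin => T ∩ coinWindow k (boxEdgesAt (ctr k u) R))).real
            {T | (T ∪ (S₁ \ coinWindow k (boxEdgesAt (ctr k u) R))) \ {(b.1, b.2, (2 : Fin 3))} ∈
              cfg k ⁻¹' B}) =
      4 * (((coinLaw k q).map (fun T : Set Coin => T ∩ coinWindow k (boxEdgesAt (ctr k u) R))).real
          {T | insert (u, 0, (2 : Fin 3)) (T ∪ (S₁ \ coinWindow k (boxEdgesAt (ctr k u) R))) ∈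
            cfg k ⁻¹' B} -
        ((coinLaw k q).map (fun T : Set Coin => T ∩ coinWindow k (boxEdgesAt (ctr k u) R))).real
          {T | (T ∪ (S₁ \ coinWindow k (boxEdgesAt (ctr k u) R))) \ {(u, 0, (2 : Fin 3))} ∈
            cfg k ⁻¹' B}) := by
  rw [sum_bundlesAt_eq_orbit u σ h (j := 2) (by decide) fun i =>
    (((coinLaw k q).map (fun T : Set Coin => T ∩ coinWindow k (boxEdgesAt (ctr k u) R))).real
        {T | insert i (T ∪ (S₁ \ coinWindow k (boxEdgesAt (ctr k u) R))) ∈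
          cfg k ⁻¹' B} -
      ((coinLaw k q).map (fun T : Set Coin => T ∩ coinWindow k (boxEdgesAt (ctr k u) R))).real
        {T | (T ∪ (S₁ \ coinWindow k (boxEdgesAt (ctr k u) R))) \ {i} ∈
          cfg k ⁻¹' B})]
  simp only [cond_infl_quarterTurn_coin_of_invariant hk q u g σ hg h0 h hR hS hB]
  ring

/-! ### The four cells at `u` -/

/-- **For an invariant pair the interior-edge conditional influence sums of the four cells at `u`
coincide** with that of the north-east cell `u`. -/
theorem sum_interiorEdges_cond_infl_eq_of_invariant {k : ℕ} (hk : k ≠ 0) (q : ℝ × ℝ) (u : Site 2)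
    (g : Site 2 ≃ Site 2) (σ : Coin ≃ Coin)
    (hg : ∀ x, g x = ![ctr k u 0 + ctr k u 1 - x 1, x 0 - ctr k u 0 + ctr k u 1])
    (h0 : ∀ (v : Site 2) (d : Fin 2), σ (v, d, 0) =
      (![v 1 - ctr k u 1 + ctr k u 0, ctr k u 0 + ctr k u 1 - v 0 - (if d = 0 then 1 else 0)],
        Equiv.swap 0 1 d, 0))
    (h : ∀ (t : Site 2) (d : Fin 2) (j : Fin 3), j ≠ 0 → σ (t, d, j) =
      (![t 1 - u 1 + u 0, u 0 + u 1 - t 0 - (if d = 0 then 1 else 0)], Equiv.swap 0 1 d, j))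
    {R : ℕ} (hR : k ∣ R) {S₁ : Set Coin}
    {B : Set (BondConfig (Site 2))} (hS : σ ⁻¹' S₁ = S₁) (hB : BondConfig.relabel (sym2Equiv g) ⁻¹' B = B) {t : Site 2}
    (ht : t ∈ cellsAt u) :
    ∑ e ∈ interiorEdges k t,
        (((coinLaw k q).map (fun T : Set Coin => T ∩ coinWindow k (boxEdgesAt (ctr k u) R))).real
            {T | insert (e.1, e.2, (0 : Fin 3)) (T ∪ (S₁ \ coinWindow k (boxEdgesAt (ctr k u) R))) ∈
              cfg k ⁻¹' B} -
          ((coinLaw k q).map (fun T : Set Coin => T ∩ coinWindow k (boxEdgesAt (ctr k u) R))).real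
            {T | (T ∪ (S₁ \ coinWindow k (boxEdgesAt (ctr k u) R))) \ {(e.1, e.2, (0 : Fin 3))} ∈
              cfg k ⁻¹' B}) =
      ∑ e ∈ interiorEdges k u,
        (((coinLaw k q).map (fun T : Set Coin => T ∩ coinWindow k (boxEdgesAt (ctr k u) R))).real
            {T | insert (e.1, e.2, (0 : Fin 3)) (T ∪ (S₁ \ coinWindow k (boxEdgesAt (ctr k u) R))) ∈
              cfg k ⁻¹' B} -
          ((coinLaw k q).map (fun T : Set Coin => T ∩ coinWindow k (boxEdgesAt (ctr k u) R))).real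
            {T | (T ∪ (S₁ \ coinWindow k (boxEdgesAt (ctr k u) R))) \ {(e.1, e.2, (0 : Fin 3))} ∈
              cfg k ⁻¹' B}) := by
  obtain ⟨e1, e2, e3⟩ := sum_interiorEdges_cellsAt_eq_orbit (Nat.pos_of_ne_zero hk) u σ h0 fun i =>
    (((coinLaw k q).map (fun T : Set Coin => T ∩ coinWindow k (boxEdgesAt (ctr k u) R))).real
        {T | insert i (T ∪ (S₁ \ coinWindow k (boxEdgesAt (ctr k u) R))) ∈
          cfg k ⁻¹' B} -
      ((coinLaw k q).map (fun T : Set Coin => T ∩ coinWindow k (boxEdgesAt (ctr k u) R))).real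
        {T | (T ∪ (S₁ \ coinWindow k (boxEdgesAt (ctr k u) R))) \ {i} ∈
          cfg k ⁻¹' B})
  simp only [cond_infl_quarterTurn_coin_of_invariant hk q u g σ hg h0 h hR hS hB] at e1 e2 e3
  simp only [cellsAt, Finset.mem_insert, Finset.mem_singleton] at ht
  rcases ht with rfl | rfl | rfl | rfl
  exacts [rfl, e3, e1, e2]

/-- **For an invariant pair the `Tc`-type conditional orbit double sum is four times the
interior-edge sum of the north-east cell `u`.** -/
theorem cellSum_cond_infl_of_invariant {k : ℕ} (hk : k ≠ 0) (q : ℝ × ℝ) (u : Site 2)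
    (g : Site 2 ≃ Site 2) (σ : Coin ≃ Coin)
    (hg : ∀ x, g x = ![ctr k u 0 + ctr k u 1 - x 1, x 0 - ctr k u 0 + ctr k u 1])
    (h0 : ∀ (v : Site 2) (d : Fin 2), σ (v, d, 0) =
      (![v 1 - ctr k u 1 + ctr k u 0, ctr k u 0 + ctr k u 1 - v 0 - (if d = 0 then 1 else 0)],
        Equiv.swap 0 1 d, 0))
    (h : ∀ (t : Site 2) (d : Fin 2) (j : Fin 3), j ≠ 0 → σ (t, d, j) =
      (![t 1 - u 1 + u 0, u 0 + u 1 - t 0 - (if d = 0 then 1 else 0)], Equiv.swap 0 1 d, j))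
    {R : ℕ} (hR : k ∣ R) {S₁ : Set Coin} {B : Set (BondConfig (Site 2))}
    (hS : σ ⁻¹' S₁ = S₁) (hB : BondConfig.relabel (sym2Equiv g) ⁻¹' B = B) :
    ∑ t ∈ cellsAt u, ∑ e ∈ interiorEdges k t,
        (((coinLaw k q).map (fun T : Set Coin => T ∩ coinWindow k (boxEdgesAt (ctr k u) R))).real
            {T | insert (e.1, e.2, (0 : Fin 3)) (T ∪ (S₁ \ coinWindow k (boxEdgesAt (ctr k u) R))) ∈
              cfg k ⁻¹' B} -
          ((coinLaw k q).map (fun T : Set Coin => T ∩ coinWindow k (boxEdgesAt (ctr k u) R))).real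
            {T | (T ∪ (S₁ \ coinWindow k (boxEdgesAt (ctr k u) R))) \ {(e.1, e.2, (0 : Fin 3))} ∈
              cfg k ⁻¹' B}) =
      4 * ∑ e ∈ interiorEdges k u,
        (((coinLaw k q).map (fun T : Set Coin => T ∩ coinWindow k (boxEdgesAt (ctr k u) R))).real
            {T | insert (e.1, e.2, (0 : Fin 3)) (T ∪ (S₁ \ coinWindow k (boxEdgesAt (ctr k u) R))) ∈
              cfg k ⁻¹' B} -
          ((coinLaw k q).map (fun T : Set Coin => T ∩ coinWindow k (boxEdgesAt (ctr k u) R))).real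
            {T | (T ∪ (S₁ \ coinWindow k (boxEdgesAt (ctr k u) R))) \ {(e.1, e.2, (0 : Fin 3))} ∈
              cfg k ⁻¹' B}) := by
  rw [sum_cellsAt_interiorEdges_eq_orbit (Nat.pos_of_ne_zero hk) u σ h0 fun i =>
    (((coinLaw k q).map (fun T : Set Coin => T ∩ coinWindow k (boxEdgesAt (ctr k u) R))).real
        {T | insert i (T ∪ (S₁ \ coinWindow k (boxEdgesAt (ctr k u) R))) ∈
          cfg k ⁻¹' B} -
      ((coinLaw k q).map (fun T : Set Coin => T ∩ coinWindow k (boxEdgesAt (ctr k u) R))).real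
        {T | (T ∪ (S₁ \ coinWindow k (boxEdgesAt (ctr k u) R))) \ {i} ∈
          cfg k ⁻¹' B})]
  simp only [cond_infl_quarterTurn_coin_of_invariant hk q u g σ hg h0 h hR hS hB]
  ring

end Summit.CriticalPhenomena.CardyFormulaZ2.Theorems.CardySelfRefinement.FarField

end
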